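import Summits.PneNP.PneNP.Theorems.ConvexRankGatesLinAlgGateBlindKonigIsGRank
import Summits.PneNP.PneNP.Theorems.ConvexRankGatesLinAlgGateBlindMatroidIntersection
import Summits.PneNP.PneNP.Theorems.ConvexRankGatesLinAlgGateBlindGalRankMeasure

/-!
# Route ConvexRankGates, crux `LinAlgGateBlind` (stmt-PneNP-10681): matroid-intersection gates over a field are GRANK gates (Edmonds 1967 in gate form)

Support theorem for the crux. The matroid-intersection door (`…MatroidInterLogWidth`) is stated for the inline class `MI_t`
(`u, w : [n] → F^D`, ACCEPT iff `θ` live inputs have both `(u_i)` and `(w_i)` independent). Over a FIELD this is exactly the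
GRANK gate `[θ ≤ rank (∑_{live i} X_i u_i w_iᵀ)]` of dimension `D` (rank-one pencil; Edmonds 1967 §5 for `u_i = e_{row}`,
`w_i = e_{col}`; Lovász 1989 §2 in general): `isGRankGate_of_matroidInterGate`.

* (⇒) a common independent `θ`-set `I` of live inputs: specialise `X_i := [i ∈ I]`; the matrix becomes `U_I W_Iᵀ` with `U_I`
  injective and `W_Iᵀ` surjective, of rank `θ`, and a non-zero `θ × θ` minor of a specialisation is non-zero generically
  (`det_submatrix_symbolicMatrix_ne_zero_of_eval_at`);
* (⇐) no common independent `θ`-set of live inputs: by linear matroid intersection (`exists_rankCover_of_no_common_independent`) a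
  split `T ⊔ T'` of the live inputs with `dim span u(T) + dim span w(T') < θ`, and
  `rank ∑_{live} X_i u_i w_iᵀ ≤ rank (U_T ·) + rank (· W_{T'}ᵀ) ≤ dim span u(T) + dim span w(T')` (base change only lowers the
  dimension of a span).

Sources: J. Edmonds, Systems of distinct representatives and linear algebra (1967) §5; L. Lovász, Singular spaces of matrices
(1989) §2. No new definitions. [folklore]
-/

-- `Summit.PneNP.PneNP.…` duplicates `PneNP` BY DESIGN (single-problem summit).
set_option linter.dupNamespace false

namespace Summit.PneNP.PneNP.Theorems

open Finset MvPolynomial Literature.Computability.Complexity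

section Eval

variable {F : Type*} [Field F] {n d : ℕ}

/-- Killing the unselected variables and then evaluating at `ω` is the evaluation `Xᵢ := [vᵢ] ωᵢ`. [folklore] -/
theorem eval_killVars_at (v : Fin n → Bool) (ω : Fin n → F) (p : MvPolynomial (Fin n) F) :
    MvPolynomial.eval ω (killVars v p) = MvPolynomial.eval (fun i => if v i then ω i else 0) p := by
  have key : (MvPolynomial.eval ω).comp
      (killVars (F := F) v : MvPolynomial (Fin n) F →ₐ[F] MvPolynomial (Fin n) F).toRingHom
      = MvPolynomial.eval fun i => if v i then ω i else 0 := by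
    refine MvPolynomial.ringHom_ext (fun a => ?_) (fun i => ?_)
    · show MvPolynomial.eval _ (killVars v (C a)) = MvPolynomial.eval _ (C a)
      simp [killVars, MvPolynomial.algebraMap_eq]
    · show MvPolynomial.eval _ (killVars v (X i)) = MvPolynomial.eval _ (X i)
      rw [killVars_X]
      split_ifs with h <;> simp [h]
  rw [← key]
  rfl

/-- The evaluation `Xᵢ := ωᵢ` of the generic symbolic matrix `K₀ + Σᵢ Xᵢ Kᵢ` is `K₀ + Σᵢ ωᵢ Kᵢ`. [folklore] -/
theorem symbolicPolyMatrix_map_eval_at (K₀ : Matrix (Fin d) (Fin d) F) (K : Fin n → Matrix (Fin d) (Fin d) F)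
    (ω : Fin n → F) :
    (symbolicPolyMatrix K₀ K).map (MvPolynomial.eval ω) = K₀ + ∑ i, ω i • K i := by
  ext a b
  simp only [symbolicPolyMatrix, Matrix.map_apply, Matrix.add_apply, Matrix.sum_apply, Matrix.smul_apply, smul_eq_mul,
    map_add, map_sum, map_mul, eval_C, eval_X]

/-- **A minor of the symbolic matrix is non-zero as soon as SOME numerical specialisation of the live variables makes it
non-zero**: if the `(r, c)`-minor of `K₀ + Σ_{vᵢ=1} ωᵢ Kᵢ` is non-zero then so is the `(r, c)`-minor of `K₀ + Σ_{vᵢ=1} Xᵢ Kᵢ`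
over `Frac F[X]`. [folklore] -/
theorem det_submatrix_symbolicMatrix_ne_zero_of_eval_at (K₀ : Matrix (Fin d) (Fin d) F)
    (K : Fin n → Matrix (Fin d) (Fin d) F) (v : Fin n → Bool) (ω : Fin n → F) {ι : Type*} [Fintype ι] [DecidableEq ι]
    (r c : ι → Fin d) (h : ((K₀ + ∑ i, (if v i then ω i else 0) • K i).submatrix r c).det ≠ 0) :
    ((symbolicMatrix K₀ K v).submatrix r c).det ≠ 0 := by
  rw [Ne, det_submatrix_symbolicMatrix_eq_zero_iff]
  intro h0
  apply h
  have h1 := congrArg (MvPolynomial.eval ω) h0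
  rw [eval_killVars_at, map_zero, RingHom.map_det, RingHom.mapMatrix_apply, ← Matrix.submatrix_map,
    symbolicPolyMatrix_map_eval_at] at h1
  exact h1

end Eval

/-- Base change only lowers the dimension of a span: for an `F`-algebra `A` and vectors `x_i ∈ F^D`, `i ∈ T`, the
`A`-span of their images in `A^D` has `A`-dimension `≤ dim_F span {x_i}`. [folklore] -/
theorem finrank_span_image_algebraMap_le {F A : Type*} [Field F] [Field A] [Algebra F A] {D n : ℕ}
    (x : Fin n → (Fin D → F)) (T : Finset (Fin n)) (S : Set (Fin D → A))
    (hS : S ⊆ Submodule.span A (((Algebra.linearMap F A).compLeft (Fin D)) '' (x '' (T : Set (Fin n))))) :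
    Module.finrank A (Submodule.span A S) ≤ Module.finrank F (Submodule.span F (x '' (T : Set (Fin n)))) := by
  classical
  set Λ := (Algebra.linearMap F A).compLeft (Fin D) with hΛ
  obtain ⟨J, hJT, hJcard, hJspan⟩ := exists_subset_card_le_finrank_span_image (F := F) x T
  -- every `x a`, `a ∈ T`, maps into the `A`-span of the images of the `x b`, `b ∈ J`
  have hsub : Λ '' (x '' (T : Set (Fin n))) ⊆ Submodule.span A (Λ '' (x '' (J : Set (Fin n)))) := by
    rintro _ ⟨y, hy, rfl⟩
    have hyF : y ∈ Submodule.span F (x '' (J : Set (Fin n))) := by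
      rw [hJspan]; exact Submodule.subset_span hy
    have h1 : Λ y ∈ (Submodule.span F (x '' (J : Set (Fin n)))).map Λ := Submodule.mem_map_of_mem hyF
    rw [Submodule.map_span] at h1
    exact Submodule.span_le_restrictScalars F A _ h1
  calc Module.finrank A (Submodule.span A S)
      ≤ Module.finrank A (Submodule.span A (Λ '' (x '' (J : Set (Fin n))))) :=
        Submodule.finrank_mono (Submodule.span_le.2 (hS.trans (Submodule.span_le.2 hsub)))
    _ ≤ #((J.image x).image Λ) := by
        rw [← coe_image, ← coe_image]; exact finrank_span_finset_le_card _
    _ ≤ #J := card_image_le.trans card_image_le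
    _ ≤ _ := hJcard

/-- **Matroid-intersection gates over a field are GRANK gates** (Edmonds 1967 / Lovász 1989, in gate form): if
`f v = 1 ↔ ∃ I ⊆ {i : vᵢ = 1}, #I = θ, dim span u(I) = θ = dim span w(I)` for vectors `u, w : [n] → F^D` over a field `F`, then
`⟨n, f⟩` is a GRANK gate of every dimension `s ≥ D`: `K₀ = 0`, `Kᵢ = uᵢ wᵢᵀ`, threshold `θ`. [folklore] -/
theorem isGRankGate_of_matroidInterGate : ∀ {F : Type} [Field F] {n D s θ : ℕ}, D ≤ s →
    ∀ (u w : Fin n → (Fin D → F)) {f : (Fin n → Bool) → Bool},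
    (∀ v, f v = true ↔ ∃ I : Finset (Fin n), (∀ i ∈ I, v i = true) ∧ #I = θ ∧
      Module.finrank F (Submodule.span F (u '' (I : Set (Fin n)))) = θ ∧
      Module.finrank F (Submodule.span F (w '' (I : Set (Fin n)))) = θ) → IsGRankGate s ⟨n, f⟩ := by
  intro F _ n D s θ hD u w f hf
  classical
  let K : Fin n → Matrix (Fin D) (Fin D) F := fun i => Matrix.vecMulVec (u i) (w i)
  refine ⟨F, inferInstance, D, θ, hD, 0, K, fun v => ?_⟩
  show f v = true ↔ _
  rw [hf v]
  constructor
  · -- (⇒) a common independent set gives a non-zero minor after specialising `X_i := [i ∈ I]`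
    rintro ⟨I, hIlive, hIcard, hIu, hIw⟩
    set ω : Fin n → F := fun i => if i ∈ I then 1 else 0 with hω
    -- the specialised matrix is `U_I W_Iᵀ`
    set A : Matrix (Fin D) I F := fun r a => u a r with hA
    set B : Matrix I (Fin D) F := fun a c => w a c with hB
    have hN : (0 : Matrix (Fin D) (Fin D) F) + ∑ i, (if v i then ω i else 0) • K i = A * B := by
      ext r c
      have hterm : ∀ i, ((if v i then ω i else 0) • K i) r c = if i ∈ I then u i r * w i c else 0 := by
        intro i
        by_cases hi : i ∈ I
        · simp [hω, hi, hIlive i hi, K, Matrix.vecMulVec_apply]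
        · simp [hω, hi, K]
      rw [Matrix.add_apply, Matrix.zero_apply, zero_add, Matrix.sum_apply, Matrix.mul_apply]
      simp only [hterm]
      rw [Finset.sum_ite_mem, Finset.univ_inter, ← Finset.sum_coe_sort]
    have hIcardT : Fintype.card I = θ := by rw [Fintype.card_coe, hIcard]
    have hrange : ∀ x : Fin n → (Fin D → F), Set.range (fun a : I => x a) = x '' (I : Set (Fin n)) := fun x =>
      Set.ext fun y => ⟨fun ⟨a, ha⟩ => ⟨a, a.2, ha⟩, fun ⟨i, hi, hy⟩ => ⟨⟨i, hi⟩, hy⟩⟩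
    have hli_u : LinearIndependent F (fun a : I => u a) := by
      rw [linearIndependent_iff_card_eq_finrank_span, hIcardT, hrange u]
      exact hIu.symm
    have hli_w : LinearIndependent F (fun a : I => w a) := by
      rw [linearIndependent_iff_card_eq_finrank_span, hIcardT, hrange w]
      exact hIw.symm
    have hrankB : B.rank = θ := (LinearIndependent.rank_matrix (M := B) hli_w).trans hIcardT
    have hrankA : A.rank = θ := by
      rw [← Matrix.rank_transpose]
      exact (LinearIndependent.rank_matrix (M := A.transpose) hli_u).trans hIcardT
    have hrangeB : LinearMap.range B.mulVecLin = ⊤ := by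
      apply Submodule.eq_top_of_finrank_eq
      rw [Module.finrank_fintype_fun_eq_card, hIcardT]
      exact hrankB
    have hrankN : θ ≤ (A * B).rank := by
      unfold Matrix.rank
      rw [Matrix.mulVecLin_mul, LinearMap.range_comp_of_range_eq_top _ hrangeB]
      exact hrankA.ge
    obtain ⟨r, c, hrc⟩ := (Literature.LinearAlgebra.Matrix.le_rank_iff_exists_det_submatrix_ne_zero (A * B)).1 hrankN
    refine (Literature.LinearAlgebra.Matrix.le_rank_iff_exists_det_submatrix_ne_zero _).2 ⟨r, c, ?_⟩
    apply det_submatrix_symbolicMatrix_ne_zero_of_eval_at 0 K v ω r c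
    rw [hN]
    exact hrc
  · -- (⇐) no common independent set: the generic rank is bounded by a covering pair (linear matroid intersection)
    intro hrank
    by_contra hno
    set L : Finset (Fin n) := univ.filter fun i => v i = true with hL
    have hno' : ¬ ∃ I ⊆ L, #I = θ ∧ Module.finrank F (Submodule.span F (u '' (I : Set (Fin n)))) = θ ∧
        Module.finrank F (Submodule.span F (w '' (I : Set (Fin n)))) = θ := by
      rintro ⟨I, hIL, hc, hu, hw⟩
      exact hno ⟨I, fun i hi => (mem_filter.1 (hIL hi)).2, hc, hu, hw⟩
    obtain ⟨T, hTL, hT⟩ := exists_rankCover_of_no_common_independent (F := F) u w L θ hno'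
    -- the symbolic matrix as a sum of two rank-one pencil pieces
    set piece : Finset (Fin n) → Matrix (Fin D) (Fin D) (FractionRing (MvPolynomial (Fin n) F)) :=
      fun S => ∑ i ∈ S, if v i then (algebraMap (MvPolynomial (Fin n) F) (FractionRing (MvPolynomial (Fin n) F)) (MvPolynomial.X i)) •
        (K i).map (algebraMap F (FractionRing (MvPolynomial (Fin n) F))) else 0 with hpiece
    have hM : symbolicMatrix 0 K v = piece T + piece (univ \ T) := by
      simp only [symbolicMatrix, hpiece, Matrix.map_zero _ (map_zero _), zero_add]
      rw [← Finset.sum_sdiff (subset_univ T), add_comm]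
    -- piece `T` factors through `U_T`
    set UT : Matrix (Fin D) T (FractionRing (MvPolynomial (Fin n) F)) := fun r a => (algebraMap F (FractionRing (MvPolynomial (Fin n) F))) (u a r) with hUT
    set VT : Matrix T (Fin D) (FractionRing (MvPolynomial (Fin n) F)) := fun a c =>
      (if v a then algebraMap (MvPolynomial (Fin n) F) (FractionRing (MvPolynomial (Fin n) F)) (MvPolynomial.X a) else 0) * (algebraMap F (FractionRing (MvPolynomial (Fin n) F))) (w a c) with hVT
    have hT1 : piece T = UT * VT := by
      ext r c
      simp only [hpiece, hUT, hVT, Matrix.sum_apply, Matrix.mul_apply]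
      rw [← Finset.sum_coe_sort T]
      refine Finset.sum_congr rfl fun a _ => ?_
      by_cases hva : v a = true
      · simp [hva, K, Matrix.vecMulVec_apply, Matrix.smul_apply, Matrix.map_apply, map_mul]
        ring
      · simp [hva]
    -- piece `univ \ T` factors through `W_(univ \ T)` (dead rows vanish)
    set UT' : Matrix (Fin D) ↥(univ \ T) (FractionRing (MvPolynomial (Fin n) F)) := fun r a => (algebraMap F (FractionRing (MvPolynomial (Fin n) F))) (u a r) with hUT'
    set VT' : Matrix ↥(univ \ T) (Fin D) (FractionRing (MvPolynomial (Fin n) F)) := fun a c =>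
      (if v a then algebraMap (MvPolynomial (Fin n) F) (FractionRing (MvPolynomial (Fin n) F)) (MvPolynomial.X a) else 0) * (algebraMap F (FractionRing (MvPolynomial (Fin n) F))) (w a c) with hVT'
    have hT2 : piece (univ \ T) = UT' * VT' := by
      ext r c
      simp only [hpiece, hUT', hVT', Matrix.sum_apply, Matrix.mul_apply]
      rw [← Finset.sum_coe_sort (univ \ T)]
      refine Finset.sum_congr rfl fun a _ => ?_
      by_cases hva : v a = true
      · simp [hva, K, Matrix.vecMulVec_apply, Matrix.smul_apply, Matrix.map_apply, map_mul]
        ring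
      · simp [hva]
    -- rank of the first factor: columns are images of the `u a`, `a ∈ T`
    have hrank1 : UT.rank ≤ Module.finrank F (Submodule.span F (u '' (T : Set (Fin n)))) := by
      rw [Matrix.rank_eq_finrank_span_cols]
      refine finrank_span_image_algebraMap_le (A := (FractionRing (MvPolynomial (Fin n) F))) u T _ ?_
      rintro _ ⟨a, rfl⟩
      refine Submodule.subset_span ⟨u a, ⟨a, a.2, rfl⟩, ?_⟩
      ext r
      simp [hUT, Matrix.col, Matrix.transpose, LinearMap.compLeft, Algebra.linearMap_apply]
    -- rank of the second factor: rows are multiples of images of the live `w a`, `a ∈ L \ T`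
    have hrank2 : VT'.rank ≤ Module.finrank F (Submodule.span F (w '' ((L \ T : Finset (Fin n)) : Set (Fin n)))) := by
      rw [Matrix.rank_eq_finrank_span_row]
      refine finrank_span_image_algebraMap_le (A := (FractionRing (MvPolynomial (Fin n) F))) w (L \ T) _ ?_
      rintro _ ⟨a, rfl⟩
      by_cases hva : v a = true
      · have haLT : (a : Fin n) ∈ ((L \ T : Finset (Fin n)) : Set (Fin n)) := by
          have ha2 := a.2
          simp only [mem_sdiff, mem_univ, true_and] at ha2
          simp [hL, hva, ha2]
        have hmem : ((Algebra.linearMap F (FractionRing (MvPolynomial (Fin n) F))).compLeft (Fin D)) (w a) ∈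
            Submodule.span (FractionRing (MvPolynomial (Fin n) F)) (((Algebra.linearMap F (FractionRing (MvPolynomial (Fin n) F))).compLeft (Fin D)) ''
              (w '' ((L \ T : Finset (Fin n)) : Set (Fin n)))) :=
          Submodule.subset_span ⟨w a, ⟨a, haLT, rfl⟩, rfl⟩
        have hrow : VT'.row a = (algebraMap (MvPolynomial (Fin n) F) (FractionRing (MvPolynomial (Fin n) F)) (MvPolynomial.X a)) •
            ((Algebra.linearMap F (FractionRing (MvPolynomial (Fin n) F))).compLeft (Fin D)) (w a) := by
          ext c
          simp [hVT', Matrix.row, hva, LinearMap.compLeft, Algebra.linearMap_apply, smul_eq_mul]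
        rw [hrow]
        exact Submodule.smul_mem _ _ hmem
      · have hrow : VT'.row a = 0 := by
          ext c
          simp [hVT', Matrix.row, hva]
        rw [hrow]
        exact Submodule.zero_mem _
    have hle : (symbolicMatrix 0 K v).rank ≤ Module.finrank F (Submodule.span F (u '' (T : Set (Fin n)))) +
        Module.finrank F (Submodule.span F (w '' ((L \ T : Finset (Fin n)) : Set (Fin n)))) := by
      rw [hM, hT1, hT2]
      calc (UT * VT + UT' * VT').rank ≤ (UT * VT).rank + (UT' * VT').rank := rank_add_le' _ _
        _ ≤ UT.rank + VT'.rank := add_le_add (Matrix.rank_mul_le_left _ _) (Matrix.rank_mul_le_right _ _)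
        _ ≤ _ := add_le_add hrank1 hrank2
    omega

/-- **`MI_t` over fields `⊆ GRANK`**: the inline class of the matroid-intersection door restricted to FIELDS consists of GRANK
gates (`isGRankGate_of_matroidInterGate`; dimension `D`, threshold `θ ≤ t`). [folklore] -/
theorem matroidInter_field_subset_gRank (t : ℕ) :
    {g : GateFn | ∃ (F : Type) (_ : Field F) (D θ : ℕ), θ ≤ t ∧ ∃ u w : Fin g.1 → (Fin D → F),
      ∀ v : Fin g.1 → Bool, g.2 v = true ↔ ∃ I : Finset (Fin g.1), (∀ i ∈ I, v i = true) ∧ #I = θ ∧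
        Module.finrank F (Submodule.span F (u '' (I : Set (Fin g.1)))) = θ ∧
        Module.finrank F (Submodule.span F (w '' (I : Set (Fin g.1)))) = θ} ⊆
    {g : GateFn | ∃ D, IsGRankGate D g} := by
  rintro ⟨k, f⟩ ⟨F, _, D, θ, -, u, w, hf⟩
  exact ⟨D, isGRankGate_of_matroidInterGate le_rfl u w hf⟩

end Summit.PneNP.PneNP.Theorems
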